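import Literature.RingTheory.LocalCohomology.CechComplex
import HarnessLib

/-!
# Čech complex: low-degree formulas and the multiplicative structure on the localisations

Topic `Literature/RingTheory/LocalCohomology`. Companion of `CechComplex.lean` (the ordered Čech
complex `Č(y; M)` of an `R`-module `M` with respect to `y_1, …, y_s ∈ R`). This file records what
the sequels on unit cocycles (line bundles on the punctured spectrum, SGA 2 XI) use:

* the faces of pairs, triples and quadruples (`(t ∘ δ_i) k`, by `rfl`) and the differentials
  `d⁰, d¹, d²` written out (`dC_pair`, `dC_triple`, `dC_quadruple`):
  `(d c)_{ij} = c_j - c_i`, `(d c)_{ijk} = c_{jk} - c_{ik} + c_{ij}`,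
  `(d c)_{ijkl} = c_{jkl} - c_{ikl} + c_{ijl} - c_{ijk}` (all restricted to `M_{y_t}`);
* the characterisation of the restriction maps `resOf`/`res` on fractions
  (`smul_resOf_mk : y_u^k • res (m / y_u^k) = m / 1`, `eq_of_smul_coe_eq`);
* for an `R`-ALGEBRA `A` (so that every `A_{y_t}` is a commutative ring, Mathlib's structure on
  `LocalizedModule _ A`): the restriction maps are ring homomorphisms (`resOf_mul`, `resOf_one`,
  `res_mul`, `res_one`, `isUnit_res`), the map induced by an algebra homomorphism is
  multiplicative (`locMap_mul`, `locMap_one`, `isUnit_locMap`), and the map induced by an `R`-linear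
  `ψ : A' → A` which is linear over a surjection-like algebra map `φ : A → A'`
  (`ψ (φ x · a') = x · ψ a'`) satisfies the same identity after localisation
  (`locMap_mul_locMap_of_semilinear`).

Everything is elementary and proved; no named facts. Mathlib searched: `LocalizedModule.mk_mul_mk`,
`LocalizedModule.algebra'`, `OreLocalization.one_def` (used); there is no ready-made
`IsLocalization` structure on `LocalizedModule S A` over `A`, so multiplicativity is proved
directly from the fraction calculus.

## References

* [Grothendieck1968SGA2] A. Grothendieck, SGA 2, Exp. XI §1 (the sheaves `𝒪*_{X_n}` and their Čech
  cocycles), arXiv:math/0511279.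
* [StacksProject] The Stacks Project, Tag 01FG (ordered Čech complex).
-/

noncomputable section

open CategoryTheory

universe u

namespace Literature.RingTheory.LocalCohomology

variable {R : Type u} [CommRing R] {s : ℕ} (y : Fin s → R) (M : Type u) [AddCommGroup M]
  [Module R M]

/-! ## Faces of pairs, triples and quadruples -/

section Faces

/-- Omitting the first index of a pair leaves the second. [folklore] -/
@[simp] theorem pair_face_zero (t : Fin 2 → Fin s) : (t ∘ Fin.succAbove 0) 0 = t 1 := rfl

/-- Omitting the second index of a pair leaves the first. [folklore] -/
@[simp] theorem pair_face_one (t : Fin 2 → Fin s) : (t ∘ Fin.succAbove 1) 0 = t 0 := rfl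

/-- Faces of a triple: `δ₀ (i,j,k) = (j,k)`. [folklore] -/
@[simp] theorem triple_face_zero (t : Fin 3 → Fin s) :
    (t ∘ Fin.succAbove 0) 0 = t 1 ∧ (t ∘ Fin.succAbove 0) 1 = t 2 := ⟨rfl, rfl⟩

/-- Faces of a triple: `δ₁ (i,j,k) = (i,k)`. [folklore] -/
@[simp] theorem triple_face_one (t : Fin 3 → Fin s) :
    (t ∘ Fin.succAbove 1) 0 = t 0 ∧ (t ∘ Fin.succAbove 1) 1 = t 2 := ⟨rfl, rfl⟩

/-- Faces of a triple: `δ₂ (i,j,k) = (i,j)`. [folklore] -/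
@[simp] theorem triple_face_two (t : Fin 3 → Fin s) :
    (t ∘ Fin.succAbove 2) 0 = t 0 ∧ (t ∘ Fin.succAbove 2) 1 = t 1 := ⟨rfl, rfl⟩

/-- Faces of a quadruple: `δ₀ (i,j,k,l) = (j,k,l)`. [folklore] -/
@[simp] theorem quadruple_face_zero (t : Fin 4 → Fin s) :
    (t ∘ Fin.succAbove 0) 0 = t 1 ∧ (t ∘ Fin.succAbove 0) 1 = t 2 ∧ (t ∘ Fin.succAbove 0) 2 = t 3 :=
  ⟨rfl, rfl, rfl⟩

/-- Faces of a quadruple: `δ₁ (i,j,k,l) = (i,k,l)`. [folklore] -/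
@[simp] theorem quadruple_face_one (t : Fin 4 → Fin s) :
    (t ∘ Fin.succAbove 1) 0 = t 0 ∧ (t ∘ Fin.succAbove 1) 1 = t 2 ∧ (t ∘ Fin.succAbove 1) 2 = t 3 :=
  ⟨rfl, rfl, rfl⟩

/-- Faces of a quadruple: `δ₂ (i,j,k,l) = (i,j,l)`. [folklore] -/
@[simp] theorem quadruple_face_two (t : Fin 4 → Fin s) :
    (t ∘ Fin.succAbove 2) 0 = t 0 ∧ (t ∘ Fin.succAbove 2) 1 = t 1 ∧ (t ∘ Fin.succAbove 2) 2 = t 3 :=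
  ⟨rfl, rfl, rfl⟩

/-- Faces of a quadruple: `δ₃ (i,j,k,l) = (i,j,k)`. [folklore] -/
@[simp] theorem quadruple_face_three (t : Fin 4 → Fin s) :
    (t ∘ Fin.succAbove 3) 0 = t 0 ∧ (t ∘ Fin.succAbove 3) 1 = t 1 ∧ (t ∘ Fin.succAbove 3) 2 = t 2 :=
  ⟨rfl, rfl, rfl⟩

end Faces

/-! ## The differentials in degrees `0`, `1`, `2` -/

section LowDegrees

variable {y M}

/-- **`d⁰` on pairs**: `(d c)_{(i,j)} = c_j|_{ij} - c_i|_{ij}`. [folklore] -/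
theorem dC_pair (c : CechObj y M 0) (t : Fin 2 → Fin s) :
    dC 0 c t = res y M t (Fin.succAbove 0) (c (t ∘ Fin.succAbove 0)) -
      res y M t (Fin.succAbove 1) (c (t ∘ Fin.succAbove 1)) := by
  rw [dC_apply, Fin.sum_univ_two]
  simp [sub_eq_add_neg]

/-- **`d¹` on triples**: `(d c)_{(i,j,k)} = c_{jk}| - c_{ik}| + c_{ij}|`. [folklore] -/
theorem dC_triple (c : CechObj y M 1) (t : Fin 3 → Fin s) :
    dC 1 c t = res y M t (Fin.succAbove 0) (c (t ∘ Fin.succAbove 0)) -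
      res y M t (Fin.succAbove 1) (c (t ∘ Fin.succAbove 1)) +
      res y M t (Fin.succAbove 2) (c (t ∘ Fin.succAbove 2)) := by
  rw [dC_apply, Fin.sum_univ_three]
  simp [sub_eq_add_neg]

/-- **`d²` on quadruples**: `(d c)_{(i,j,k,l)} = c_{jkl}| - c_{ikl}| + c_{ijl}| - c_{ijk}|`. [folklore] -/
theorem dC_quadruple (c : CechObj y M 2) (t : Fin 4 → Fin s) :
    dC 2 c t = res y M t (Fin.succAbove 0) (c (t ∘ Fin.succAbove 0)) -
      res y M t (Fin.succAbove 1) (c (t ∘ Fin.succAbove 1)) +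
      res y M t (Fin.succAbove 2) (c (t ∘ Fin.succAbove 2)) -
      res y M t (Fin.succAbove 3) (c (t ∘ Fin.succAbove 3)) := by
  rw [dC_apply, Fin.sum_univ_four]
  simp only [Fin.val_zero, pow_zero, one_smul, Fin.val_one, pow_one, neg_smul, Fin.val_two]
  have h3 : ((3 : Fin 4) : ℕ) = 3 := rfl
  rw [h3]
  simp only [show ((-1 : ℤ) ^ 2) = 1 by norm_num, show ((-1 : ℤ) ^ 3) = -1 by norm_num, one_smul,
    neg_smul]
  abel

/-- `d¹ ∘ d⁰ = 0`, concretely. [folklore] -/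
theorem dC_one_dC_zero (c : CechObj y M 0) : dC 1 (dC 0 c) = 0 := by
  have h : ((cechComplex y M).d 0 1 ≫ (cechComplex y M).d 1 2).hom c = 0 := by
    rw [(cechComplex y M).d_comp_d]; rfl
  rw [ModuleCat.hom_comp] at h
  exact h

/-- `d² ∘ d¹ = 0`, concretely. [folklore] -/
theorem dC_two_dC_one (c : CechObj y M 1) : dC 2 (dC 1 c) = 0 := by
  have h : ((cechComplex y M).d 1 2 ≫ (cechComplex y M).d 2 3).hom c = 0 := by
    rw [(cechComplex y M).d_comp_d]; rfl
  rw [ModuleCat.hom_comp] at h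
  exact h

end LowDegrees

/-! ## Restriction maps on fractions -/

section Fractions

variable {y M}

/-- The powers of `y_u` act injectively on `M_{y_t}` when `y_u` divides a power of `y_t`.
[folklore] -/
theorem eq_of_smul_coe_eq {n n' : ℕ} {u : Fin n' → Fin s} {t : Fin n → Fin s}
    (h : ∃ K, tupleProd y u ∣ tupleProd y t ^ K) (p : Submonoid.powers (tupleProd y u))
    {z z' : CechLoc y M t} (hz : (p : R) • z = (p : R) • z') : z = z' := by
  have hu := isUnit_algebraMap_end_cechLoc_of_dvd (M := M) h p
  rw [Module.End.isUnit_iff] at hu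
  exact hu.1 hz

/-- **`resOf` on fractions**: `y_u^k • resOf (m / y_u^k) = m / 1`. [folklore] -/
theorem smul_resOf_mk {n n' : ℕ} (u : Fin n' → Fin s) (t : Fin n → Fin s)
    (h : ∃ K, tupleProd y u ∣ tupleProd y t ^ K) (m : M) (p : Submonoid.powers (tupleProd y u)) :
    (p : R) • resOf y M u t h (LocalizedModule.mk m p) = LocalizedModule.mk m 1 := by
  rw [← LinearMap.map_smul, LocalizedModule.smul'_mk, ← resOf_mk_one y M u t h m]
  congr 1
  rw [← LocalizedModule.mk_cancel p m, Submonoid.smul_def]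

/-- **`res` on fractions**: `y_{t∘θ}^k • res (m / y_{t∘θ}^k) = m / 1`. [folklore] -/
theorem smul_res_mk {n n' : ℕ} (t : Fin n → Fin s) (θ : Fin n' → Fin n) (m : M)
    (p : Submonoid.powers (tupleProd y (t ∘ θ))) :
    (p : R) • res y M t θ (LocalizedModule.mk m p) = LocalizedModule.mk m 1 :=
  smul_resOf_mk _ _ _ m p

end Fractions

/-! ## Algebras: the localisations are rings and the structure maps are ring homomorphisms -/

section Algebra

variable (A : Type u) [CommRing A] [Algebra R A]

/-- `1 = 1/1` in `A_{y_t}`. [folklore] -/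
theorem one_eq_mk_one {n : ℕ} (t : Fin n → Fin s) :
    (1 : CechLoc y A t) = LocalizedModule.mk 1 1 :=
  OreLocalization.one_def

/-- `r ↦ r/1`: the algebra map `R → A_{y_t}` on elements. [folklore] -/
theorem algebraMap_cechLoc_apply {n : ℕ} (t : Fin n → Fin s) (r : R) :
    algebraMap R (CechLoc y A t) r = LocalizedModule.mk (algebraMap R A r) 1 := rfl

/-- **`resOf` is multiplicative.** [folklore] -/
theorem resOf_mul {n n' : ℕ} (u : Fin n' → Fin s) (t : Fin n → Fin s)
    (h : ∃ K, tupleProd y u ∣ tupleProd y t ^ K) (a b : CechLoc y A u) :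
    resOf y A u t h (a * b) = resOf y A u t h a * resOf y A u t h b := by
  induction a using LocalizedModule.induction_on with | h a p => ?_
  induction b using LocalizedModule.induction_on with | h b q => ?_
  rw [LocalizedModule.mk_mul_mk]
  apply eq_of_smul_coe_eq (M := A) h (p * q)
  rw [smul_resOf_mk, Submonoid.coe_mul, ← smul_mul_smul_comm, smul_resOf_mk, smul_resOf_mk,
    LocalizedModule.mk_mul_mk, one_mul]

/-- **`resOf` preserves `1`.** [folklore] -/
theorem resOf_one {n n' : ℕ} (u : Fin n' → Fin s) (t : Fin n → Fin s)
    (h : ∃ K, tupleProd y u ∣ tupleProd y t ^ K) : resOf y A u t h 1 = 1 := by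
  rw [one_eq_mk_one, resOf_mk_one, one_eq_mk_one]

/-- **`res` is multiplicative.** [folklore] -/
theorem res_mul {n n' : ℕ} (t : Fin n → Fin s) (θ : Fin n' → Fin n) (a b : CechLoc y A (t ∘ θ)) :
    res y A t θ (a * b) = res y A t θ a * res y A t θ b :=
  resOf_mul y A _ _ _ a b

/-- **`res` preserves `1`.** [folklore] -/
theorem res_one {n n' : ℕ} (t : Fin n → Fin s) (θ : Fin n' → Fin n) : res y A t θ 1 = 1 :=
  resOf_one y A _ _ _

/-- Restriction preserves units. [folklore] -/
theorem isUnit_res {n n' : ℕ} (t : Fin n → Fin s) (θ : Fin n' → Fin n) {a : CechLoc y A (t ∘ θ)}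
    (ha : IsUnit a) : IsUnit (res y A t θ a) := by
  obtain ⟨b, hb⟩ := ha.exists_right_inv
  exact IsUnit.of_mul_eq_one (res y A t θ b) (by rw [← res_mul, hb, res_one])

/-- Restriction (general form) preserves units. [folklore] -/
theorem isUnit_resOf {n n' : ℕ} (u : Fin n' → Fin s) (t : Fin n → Fin s)
    (h : ∃ K, tupleProd y u ∣ tupleProd y t ^ K) {a : CechLoc y A u} (ha : IsUnit a) :
    IsUnit (resOf y A u t h a) := by
  obtain ⟨b, hb⟩ := ha.exists_right_inv
  exact IsUnit.of_mul_eq_one (resOf y A u t h b) (by rw [← resOf_mul, hb, resOf_one])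

variable {A} {A' : Type u} [CommRing A'] [Algebra R A']

/-- **The map induced by an algebra homomorphism is multiplicative.** [folklore] -/
theorem locMap_mul (φ : A →ₐ[R] A') {n : ℕ} (t : Fin n → Fin s) (a b : CechLoc y A t) :
    locMap y φ.toLinearMap t (a * b) = locMap y φ.toLinearMap t a * locMap y φ.toLinearMap t b := by
  induction a using LocalizedModule.induction_on with | h a p => ?_
  induction b using LocalizedModule.induction_on with | h b q => ?_
  rw [LocalizedModule.mk_mul_mk, locMap_mk, locMap_mk, locMap_mk, LocalizedModule.mk_mul_mk]
  simp

/-- The map induced by an algebra homomorphism preserves `1`. [folklore] -/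
theorem locMap_one (φ : A →ₐ[R] A') {n : ℕ} (t : Fin n → Fin s) :
    locMap y φ.toLinearMap t (1 : CechLoc y A t) = 1 := by
  rw [one_eq_mk_one, locMap_mk, one_eq_mk_one]
  simp

/-- The map induced by an algebra homomorphism preserves units. [folklore] -/
theorem isUnit_locMap (φ : A →ₐ[R] A') {n : ℕ} (t : Fin n → Fin s) {a : CechLoc y A t}
    (ha : IsUnit a) : IsUnit (locMap y φ.toLinearMap t a) := by
  obtain ⟨b, hb⟩ := ha.exists_right_inv
  exact IsUnit.of_mul_eq_one (locMap y φ.toLinearMap t b) (by rw [← locMap_mul, hb, locMap_one])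

/-- **Semilinearity survives localisation.** If `φ : A → A'` is an algebra map and the `R`-linear
`ψ : A' → A` satisfies `ψ (φ x · a') = x · ψ a'` (i.e. `ψ` is `A`-linear for the `A`-module structure
of `A'` through `φ`), then `ψ (φ X · Z) = X · ψ Z` on `A_{y_t}`, `A'_{y_t}`. Used for the maps
"multiplication by `t^j`" `S/t^b → S/t^a` between the levels of an adic tower. [folklore] -/
theorem locMap_mul_locMap_of_semilinear (φ : A →ₐ[R] A') (ψ : A' →ₗ[R] A)
    (hψ : ∀ (x : A) (a' : A'), ψ (φ x * a') = x * ψ a') {n : ℕ} (t : Fin n → Fin s)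
    (X : CechLoc y A t) (Z : CechLoc y A' t) :
    locMap y ψ t (locMap y φ.toLinearMap t X * Z) = X * locMap y ψ t Z := by
  induction X using LocalizedModule.induction_on with | h x p => ?_
  induction Z using LocalizedModule.induction_on with | h z q => ?_
  rw [locMap_mk, LocalizedModule.mk_mul_mk, locMap_mk, locMap_mk, LocalizedModule.mk_mul_mk]
  simp [hψ]

end Algebra

end Literature.RingTheory.LocalCohomology

end
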